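import Literature.Barriers.AtomisticToContinuum.KineticGapLengthScalesNarrow
import Summits.AtomisticToContinuum.BoseEinsteinCondensation.Theorems.GaussianDominationCan.Negative.ProductCalculus
import HarnessLib

/-!
# Crux `GridInfDivCoherence` (stmt-AtomisticToContinuum-9114), line `registered`: the boost step
# `stub_exists_boost_cellCoherence_neg` of the positivity-necessity theorem (lead c6)

For a periodic trial state `Ψ` on the torus of side `L > 0`, a particle `i` and a shift `r ∉ Lℤ³` at
which the cell coherence `z = ∫_{cell^N} conj Ψ(…, xᵢ + r, …) Ψ(X) dX` has `re z > 0`, some Galilei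
boost `Ψ_m = e^{2πi m·∑ⱼxⱼ/L} Ψ` (`PeriodicTrialState.boost`) has NEGATIVE cell coherence at the same
`(i, r)`.

Proof. Pointwise, by the slice identity `boost_update` and `|e_m| = 1`,
`conj Ψ_m(…, xᵢ + r, …) Ψ_m(X) = conj(e_m(r)) · conj Ψ(…, xᵢ + r, …) Ψ(X)`, so the boosted coherence
is `re(conj(e_m(r)) z)`; for the pair `±m` the two values sum to `2 re(e_m(r)) re z`. Since
`r ∉ Lℤ³` some coordinate `r_a / L` is not an integer, and then (elementary) some integer `c` has
`cos(2π c r_a / L) < 0`; with `m = c e_a`, `re(e_m(r)) = cos(2π c r_a / L) < 0`, so one of the two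
boosted coherences is negative.

References: [LSSY2005] Lieb–Seiringer–Solovej–Yngvason, *The Mathematics of the Bose Gas and its
Condensation*, Ch. 5 §5.2 footnote 2 (boosted states / gauge transformation).
-/

noncomputable section

namespace Summit.AtomisticToContinuum.BoseEinsteinCondensation.Theorems

open MeasureTheory Filter Literature.MathematicalPhysics.QuantumManyBody Literature.MathematicalPhysics.QuantumManyBody.BoseGas
open Literature.Barriers.AtomisticToContinuum.BoseGas
open scoped ENNReal NNReal ComplexConjugate

namespace BoostCoherenceNeg

open GaussianDominationCan.Negative (conj_cellWave_mul_self)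

variable {N : ℕ} {L : ℝ}

/-- **Pointwise boost identity for the coherence integrand**:
`conj Ψ_m(…, xᵢ + r, …) · Ψ_m(X) = conj(e_m(r)) · (conj Ψ(…, xᵢ + r, …) · Ψ(X))`
(slice identity `boost_update` at `xᵢ + r` and at `xᵢ`, `e_m(xᵢ + r) = e_m(xᵢ) e_m(r)`, and
`conj(e_m) e_m = 1`, `GaussianDominationCan.Negative.conj_cellWave_mul_self`). [folklore] -/
theorem conj_boost_update_mul_boost (hL : 0 < L) (m : Fin 3 → ℤ) (Ψ : PeriodicTrialState N L)
    (X : Config N) (i : Fin N) (r : Space) :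
    conj ((Ψ.boost hL m).ψ (Function.update X i (X i + r))) * (Ψ.boost hL m).ψ X =
      conj (cellWave L m r) * (conj (Ψ.ψ (Function.update X i (X i + r))) * Ψ.ψ X) := by
  have hX : (Ψ.boost hL m).ψ X =
      cellWave L m (∑ j ∈ Finset.univ.erase i, X j) * (cellWave L m (X i) * Ψ.ψ X) := by
    conv_lhs => rw [← Function.update_eq_self i X]
    rw [boost_update, Function.update_eq_self]
  rw [boost_update, hX, cellWave_add, map_mul, map_mul, map_mul]
  calc _ = (conj (cellWave L m (∑ j ∈ Finset.univ.erase i, X j)) *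
          cellWave L m (∑ j ∈ Finset.univ.erase i, X j)) *
        (conj (cellWave L m (X i)) * cellWave L m (X i)) *
        (conj (cellWave L m r) * (conj (Ψ.ψ (Function.update X i (X i + r))) * Ψ.ψ X)) := by ring
    _ = _ := by rw [conj_cellWave_mul_self, conj_cellWave_mul_self, one_mul, one_mul]

/-- **The boosted cell coherence is the unboosted one times the phase `conj(e_m(r))`.** [folklore] -/
theorem integral_conj_boost_update_mul_boost (hL : 0 < L) (m : Fin 3 → ℤ)
    (Ψ : PeriodicTrialState N L) (i : Fin N) (r : Space) :
    ∫ X in cellN N L, conj ((Ψ.boost hL m).ψ (Function.update X i (X i + r))) *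
        (Ψ.boost hL m).ψ X =
      conj (cellWave L m r) *
        ∫ X in cellN N L, conj (Ψ.ψ (Function.update X i (X i + r))) * Ψ.ψ X := by
  simp_rw [conj_boost_update_mul_boost]
  exact integral_const_mul _ _

/-- Real part of the plane wave along one axis: `re e_{c e_a}(r) = cos(2π c r_a / L)`. [folklore] -/
theorem re_cellWave_single (L : ℝ) (a : Fin 3) (c : ℤ) (r : Space) :
    (cellWave L (Pi.single a c) r).re = Real.cos (2 * Real.pi * c * (r a / L)) := by
  rw [cellWave_apply]
  have : (2 * ↑Real.pi * Complex.I * ↑(∑ k, ((Pi.single a c : Fin 3 → ℤ) k : ℝ) * r k) / ↑L : ℂ) =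
      ((2 * Real.pi * c * (r a / L) : ℝ) : ℂ) * Complex.I := by
    simp only [Pi.single_apply, Int.cast_ite, Int.cast_zero, ite_mul, zero_mul,
      Finset.sum_ite_eq', Finset.mem_univ, if_true]
    push_cast
    ring
  rw [this, Complex.exp_ofReal_mul_I_re]

/-- `cos(2πx) < 0` for `x ∈ (1/4, 3/4)`. [folklore] -/
theorem cos_two_pi_mul_neg {x : ℝ} (h1 : 1 / 4 < x) (h2 : x < 3 / 4) :
    Real.cos (2 * Real.pi * x) < 0 :=
  Real.cos_neg_of_pi_div_two_lt_of_lt (by nlinarith [Real.pi_pos]) (by nlinarith [Real.pi_pos])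

/-- For `0 < s ≤ 1/2` some natural multiple `c s` lies in `(1/4, 3/4)`: `c = 1` if `s > 1/4`, else
`c = ⌈1/(3s)⌉`, for which `1/3 ≤ c s < 1/3 + s ≤ 7/12`. [folklore] -/
theorem exists_nat_mul_mem {s : ℝ} (hs0 : 0 < s) (hs1 : s ≤ 1 / 2) :
    ∃ c : ℕ, 1 / 4 < c * s ∧ c * s < 3 / 4 := by
  rcases lt_or_ge (1 / 4 : ℝ) s with h | h
  · exact ⟨1, by push_cast; linarith, by push_cast; linarith⟩
  · have hc1 : 1 / (3 * s) ≤ (⌈1 / (3 * s)⌉₊ : ℝ) := Nat.le_ceil _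
    have hc2 : (⌈1 / (3 * s)⌉₊ : ℝ) < 1 / (3 * s) + 1 := Nat.ceil_lt_add_one (by positivity)
    rw [div_le_iff₀ (by positivity)] at hc1
    have hc3 : (⌈1 / (3 * s)⌉₊ : ℝ) * (3 * s) < (1 / (3 * s) + 1) * (3 * s) :=
      mul_lt_mul_of_pos_right hc2 (by positivity)
    rw [add_mul, div_mul_cancel₀ _ (by positivity)] at hc3
    exact ⟨⌈1 / (3 * s)⌉₊, by linarith, by linarith⟩

/-- **For real `t ∉ ℤ` some multiple has `cos(2π c t) < 0`** (reduce to `s = fract t` or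
`s = 1 - fract t` in `(0, 1/2]` by periodicity and evenness of `cos`, then `exists_nat_mul_mem`).
[folklore] -/
theorem exists_cos_two_pi_mul_neg {t : ℝ} (ht : ∀ n : ℤ, t ≠ n) :
    ∃ c : ℕ, Real.cos (2 * Real.pi * c * t) < 0 := by
  have hs0 : 0 < Int.fract t := Int.fract_pos.2 (ht ⌊t⌋)
  have hs1 : Int.fract t < 1 := Int.fract_lt_one t
  have ht' : Int.fract t + ⌊t⌋ = t := Int.fract_add_floor t
  rcases le_or_gt (Int.fract t) (1 / 2) with h | h
  · obtain ⟨c, hc1, hc2⟩ := exists_nat_mul_mem hs0 h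
    refine ⟨c, ?_⟩
    have : 2 * Real.pi * c * t =
        2 * Real.pi * (c * Int.fract t) + ((c * ⌊t⌋ : ℤ) : ℝ) * (2 * Real.pi) := by
      push_cast
      linear_combination (-(2 * Real.pi * c)) * ht'
    rw [this, Real.cos_add_int_mul_two_pi]
    exact cos_two_pi_mul_neg hc1 hc2
  · obtain ⟨c, hc1, hc2⟩ := exists_nat_mul_mem (s := 1 - Int.fract t) (by linarith) (by linarith)
    refine ⟨c, ?_⟩
    have : 2 * Real.pi * c * t =
        -(2 * Real.pi * (c * (1 - Int.fract t))) + ((c * (⌊t⌋ + 1) : ℤ) : ℝ) * (2 * Real.pi) := by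
      push_cast
      linear_combination (-(2 * Real.pi * c)) * ht'
    rw [this, Real.cos_add_int_mul_two_pi, Real.cos_neg]
    exact cos_two_pi_mul_neg hc1 hc2

/-- **A vector not in `Lℤ³` has a coordinate outside `Lℤ`** (contrapositive: if every `r_a / L` is an
integer `n_a` then `r = latticeVec L n`). [folklore] -/
theorem exists_coord_div_ne_int (hL : 0 < L) {r : Space}
    (hr : ¬ ∃ n : Fin 3 → ℤ, r = latticeVec L n) : ∃ a : Fin 3, ∀ n : ℤ, r a / L ≠ n := by
  by_contra h
  push Not at h
  choose n hn using h
  refine hr ⟨n, ?_⟩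
  ext k
  rw [latticeVec_apply, ← hn k]
  field_simp

end BoostCoherenceNeg

open BoostCoherenceNeg in
/-- **`stub_exists_boost_cellCoherence_neg`** (registered by lead c6; boost step of the positivity-necessity
theorem `reTranslate_groundState_pos_of_slack`). For a periodic trial state `Ψ`, a particle `i` and a
shift `r ∉ Lℤ³` at which the cell coherence `z = ∫_{cell^N} conj Ψ(…, xᵢ + r, …) Ψ(X) dX` has `re z > 0`,
some Galilei boost `Ψ_m = e^{2πi m·∑ⱼxⱼ/L} Ψ` (`PeriodicTrialState.boost`) has NEGATIVE cell coherence at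
the same `(i, r)`: by `boost_update`, the boosted coherence is `re(conj(e_m(r)) z)`
(`integral_conj_boost_update_mul_boost`), and for the pair `±m` the two values sum to
`2 re(e_m(r)) · re z`; with `m = c e_a` for a coordinate `r_a / L ∉ ℤ` (`exists_coord_div_ne_int`) and
`c` with `cos(2π c r_a / L) < 0` (`exists_cos_two_pi_mul_neg`) this sum is negative, so one of the two
boosted coherences is `< 0`. [cite: LSSY2005, Ch. 5 footnote 2] -/
theorem stub_exists_boost_cellCoherence_neg :
    ∀ (N : ℕ) (L : ℝ) (hL : 0 < L) (Ψ : PeriodicTrialState N L) (i : Fin N) (r : EuclideanSpace ℝ (Fin 3)),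
      (¬ ∃ n : Fin 3 → ℤ, r = latticeVec L n) →
      0 < (∫ X in cellN N L, conj (Ψ.ψ (Function.update X i (X i + r))) * Ψ.ψ X).re →
      ∃ m : Fin 3 → ℤ,
        (∫ X in cellN N L, conj ((Ψ.boost hL m).ψ (Function.update X i (X i + r))) *
          (Ψ.boost hL m).ψ X).re < 0 := by
  intro N L hL Ψ i r hr hpos
  obtain ⟨a, ha⟩ := exists_coord_div_ne_int hL hr
  obtain ⟨c, hc⟩ := exists_cos_two_pi_mul_neg ha
  set z := ∫ X in cellN N L, conj (Ψ.ψ (Function.update X i (X i + r))) * Ψ.ψ X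
  have hre : (cellWave L (Pi.single a (c : ℤ)) r).re = Real.cos (2 * Real.pi * c * (r a / L)) := by
    rw [re_cellWave_single, Int.cast_natCast]
  have h1 : (∫ X in cellN N L, conj ((Ψ.boost hL (Pi.single a (c : ℤ))).ψ
      (Function.update X i (X i + r))) * (Ψ.boost hL (Pi.single a (c : ℤ))).ψ X).re =
        (cellWave L (Pi.single a (c : ℤ)) r).re * z.re +
          (cellWave L (Pi.single a (c : ℤ)) r).im * z.im := by
    rw [integral_conj_boost_update_mul_boost, Complex.mul_re, Complex.conj_re, Complex.conj_im]
    ring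
  have h2 : (∫ X in cellN N L, conj ((Ψ.boost hL (-Pi.single a (c : ℤ))).ψ
      (Function.update X i (X i + r))) * (Ψ.boost hL (-Pi.single a (c : ℤ))).ψ X).re =
        (cellWave L (Pi.single a (c : ℤ)) r).re * z.re -
          (cellWave L (Pi.single a (c : ℤ)) r).im * z.im := by
    rw [integral_conj_boost_update_mul_boost, ← conj_cellWave, Complex.conj_conj, Complex.mul_re]
  have hneg : (cellWave L (Pi.single a (c : ℤ)) r).re * z.re < 0 :=
    mul_neg_of_neg_of_pos (hre ▸ hc) hpos
  rcases lt_or_ge ((cellWave L (Pi.single a (c : ℤ)) r).im * z.im) 0 with h | h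
  · exact ⟨Pi.single a (c : ℤ), by rw [h1]; linarith⟩
  · exact ⟨-Pi.single a (c : ℤ), by rw [h2]; linarith⟩

end Summit.AtomisticToContinuum.BoseEinsteinCondensation.Theorems

end
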